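import Summits.AtomisticToContinuum.Crystallization.Theorems.FreeSplittingCertificatesStrictSplittingRuleCoreDefsStar
import Summits.AtomisticToContinuum.Crystallization.Theorems.FreeSplittingCertificatesStrictSplittingRuleCoreFirstOrderDesignGeometry
import Summits.AtomisticToContinuum.Crystallization.Theorems.FreeSplittingCertificatesStrictSplittingRuleCoreHall

/-!
# Second-order Taylor bound for the squared-length Lennard-Jones well

Helper of reshape r5 (lead c5) of crux `StrictSplittingRule` (stmt-AtomisticToContinuum-12560), line `registered`.
Registered stub, landed `--supports stmt-AtomisticToContinuum-12560`.
-/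

noncomputable section

namespace Summit.AtomisticToContinuum.Crystallization.Theorems.StrictSplittingRuleBirth

open scoped BigOperators Classical
open Literature.MathematicalPhysics.StatisticalMechanics
open Literature.Geometry.DiscreteGeometry
open Summit.AtomisticToContinuum.Crystallization.Theorems.PalmUnimodularRigidity.LayeredLawsSelectHcp
  (hcpSite ljSqDeriv)

/-- Exact third-order remainder identity for `W(s) = s⁻⁶/12 − s⁻³/6` about `s₀`: with `u = ε/s₀` and
`y = (s₀+ε)⁻¹`, `W(s₀+ε) − W(s₀) − W′(s₀)ε − ½W″(s₀)ε² = −u³ (y⁶ Q₆(u)/12 − y³ Q₃(u)/6)` where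
`Q₆(u) = 56 + 210u + 336u² + 280u³ + 120u⁴ + 21u⁵`, `Q₃(u) = 10 + 15u + 6u²`. [folklore] -/
theorem ljSqTaylor_identity (s₀ ε : ℝ) (hs : s₀ ≠ 0) (ht : s₀ + ε ≠ 0) :
    (1 / 12 * ((s₀ + ε)⁻¹) ^ 6 - 1 / 6 * ((s₀ + ε)⁻¹) ^ 3) - (1 / 12 * (s₀⁻¹) ^ 6 - 1 / 6 * (s₀⁻¹) ^ 3)
      - 1 / 2 * ((s₀⁻¹) ^ 4 - (s₀⁻¹) ^ 7) * ε
      - 1 / 2 * (1 / 2 * (7 * (s₀⁻¹) ^ 8 - 4 * (s₀⁻¹) ^ 5)) * ε ^ 2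
    = -(ε * s₀⁻¹) ^ 3 * (((s₀ + ε)⁻¹) ^ 6 * (56 + 210 * (ε * s₀⁻¹) + 336 * (ε * s₀⁻¹) ^ 2
        + 280 * (ε * s₀⁻¹) ^ 3 + 120 * (ε * s₀⁻¹) ^ 4 + 21 * (ε * s₀⁻¹) ^ 5) / 12
        - ((s₀ + ε)⁻¹) ^ 3 * (10 + 15 * (ε * s₀⁻¹) + 6 * (ε * s₀⁻¹) ^ 2) / 6) := by
  field_simp
  ring

/-- Two-sided power bounds `−5⁻ᵏ ≤ uᵏ ≤ 5⁻ᵏ` from `|u| ≤ 1/5`. [folklore] -/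
theorem ljSqTaylor_pow_bounds (u : ℝ) (hu : |u| ≤ 1 / 5) (k : ℕ) :
    -(1 / 5 : ℝ) ^ k ≤ u ^ k ∧ u ^ k ≤ (1 / 5) ^ k :=
  abs_le.1 (by rw [abs_pow]; exact pow_le_pow_left₀ (abs_nonneg u) hu k)

/-- Bound for the `s⁻⁶` part of the remainder: `|y⁶ Q₆(u)| ≤ 420 x⁶` when `y(1+u) = x`, `y > 0`,
`|u| ≤ 1/5`. [folklore] -/
theorem ljSqTaylor_bound6 (u x y : ℝ) (hu : |u| ≤ 1 / 5) (hy : 0 < y) (hrel : y * (1 + u) = x) :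
    |y ^ 6 * (56 + 210 * u + 336 * u ^ 2 + 280 * u ^ 3 + 120 * u ^ 4 + 21 * u ^ 5)| ≤ 420 * x ^ 6 := by
  have h1 := abs_le.1 hu
  have h2 := ljSqTaylor_pow_bounds u hu 2
  have h3 := ljSqTaylor_pow_bounds u hu 3
  have h4 := ljSqTaylor_pow_bounds u hu 4
  have h5 := ljSqTaylor_pow_bounds u hu 5
  norm_num at h2 h3 h4 h5
  have hu2 : 0 ≤ u ^ 2 := by positivity
  have hu4 : 0 ≤ u ^ 4 := by positivity
  have hx : 0 < x := by rw [← hrel]; nlinarith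
  rcases le_total 0 u with hu0 | hu0
  · have hu3 : 0 ≤ u ^ 3 := pow_nonneg hu0 3
    have hu5 : 0 ≤ u ^ 5 := pow_nonneg hu0 5
    have hQnn : 0 ≤ 56 + 210 * u + 336 * u ^ 2 + 280 * u ^ 3 + 120 * u ^ 4 + 21 * u ^ 5 := by
      linarith
    have hQle : 56 + 210 * u + 336 * u ^ 2 + 280 * u ^ 3 + 120 * u ^ 4 + 21 * u ^ 5 ≤ 114 := by
      linarith
    have hyx : y ≤ x := by nlinarith [mul_nonneg hy.le hu0]
    have hy6 : y ^ 6 ≤ x ^ 6 := pow_le_pow_left₀ hy.le hyx 6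
    rw [abs_of_nonneg (mul_nonneg (pow_nonneg hy.le 6) hQnn)]
    calc y ^ 6 * (56 + 210 * u + 336 * u ^ 2 + 280 * u ^ 3 + 120 * u ^ 4 + 21 * u ^ 5)
        ≤ x ^ 6 * 114 := mul_le_mul hy6 hQle hQnn (pow_nonneg hx.le 6)
      _ ≤ 420 * x ^ 6 := by nlinarith [pow_nonneg hx.le 6]
  · have hu3 : u ^ 3 ≤ 0 := Odd.pow_nonpos ⟨1, by norm_num⟩ hu0
    have hu5 : u ^ 5 ≤ 0 := Odd.pow_nonpos ⟨2, by norm_num⟩ hu0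
    have hQnn : 0 ≤ 56 + 210 * u + 336 * u ^ 2 + 280 * u ^ 3 + 120 * u ^ 4 + 21 * u ^ 5 := by
      linarith
    have hQle : 56 + 210 * u + 336 * u ^ 2 + 280 * u ^ 3 + 120 * u ^ 4 + 21 * u ^ 5 ≤ 70 := by
      linarith
    have hyx : y ≤ 5 / 4 * x := by nlinarith [mul_nonneg hy.le (by linarith : 0 ≤ u + 1 / 5)]
    have hy6 : y ^ 6 ≤ (5 / 4 * x) ^ 6 := pow_le_pow_left₀ hy.le hyx 6
    rw [abs_of_nonneg (mul_nonneg (pow_nonneg hy.le 6) hQnn)]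
    calc y ^ 6 * (56 + 210 * u + 336 * u ^ 2 + 280 * u ^ 3 + 120 * u ^ 4 + 21 * u ^ 5)
        ≤ (5 / 4 * x) ^ 6 * 70 := mul_le_mul hy6 hQle hQnn (by positivity)
      _ ≤ 420 * x ^ 6 := by nlinarith [pow_nonneg hx.le 6]

/-- Bound for the `s⁻³` part of the remainder: `|y³ Q₃(u)| ≤ 42 x³` when `y(1+u) = x`, `y > 0`,
`|u| ≤ 1/5`. [folklore] -/
theorem ljSqTaylor_bound3 (u x y : ℝ) (hu : |u| ≤ 1 / 5) (hy : 0 < y) (hrel : y * (1 + u) = x) :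
    |y ^ 3 * (10 + 15 * u + 6 * u ^ 2)| ≤ 42 * x ^ 3 := by
  have h1 := abs_le.1 hu
  have h2 := ljSqTaylor_pow_bounds u hu 2
  norm_num at h2
  have hu2 : 0 ≤ u ^ 2 := by positivity
  have hx : 0 < x := by rw [← hrel]; nlinarith
  have hQnn : 0 ≤ 10 + 15 * u + 6 * u ^ 2 := by linarith
  have hQle : 10 + 15 * u + 6 * u ^ 2 ≤ 14 := by linarith
  have hyx : y ≤ 5 / 4 * x := by nlinarith [mul_nonneg hy.le (by linarith : 0 ≤ u + 1 / 5)]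
  have hy3 : y ^ 3 ≤ (5 / 4 * x) ^ 3 := pow_le_pow_left₀ hy.le hyx 3
  rw [abs_of_nonneg (mul_nonneg (pow_nonneg hy.le 3) hQnn)]
  calc y ^ 3 * (10 + 15 * u + 6 * u ^ 2)
      ≤ (5 / 4 * x) ^ 3 * 14 := mul_le_mul hy3 hQle hQnn (by positivity)
    _ ≤ 42 * x ^ 3 := by nlinarith [pow_nonneg hx.le 3]

/-- **stub_ljSqTaylor** (r5 helper, H3⋆ cubic remainders): second-order Taylor bound for the squared-length
Lennard-Jones well `W(s) = s⁻⁶/12 − s⁻³/6` (`= V_LJ(√s)`), with `W′ = ljSqDeriv`, `W″(s) = ½(7s⁻⁸ − 4s⁻⁵)`: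
for `s₀ > 0` and `|ε| ≤ s₀/5`, `|W(s₀+ε) − W(s₀) − W′(s₀)ε − ½W″(s₀)ε²| ≤ (35 s₀⁻⁹ + 7 s₀⁻⁶)|ε|³`
(Lagrange: `|W‴| ≤ 28ξ⁻⁹ + 10ξ⁻⁶` on `ξ ≥ 4s₀/5`). [folklore] -/
theorem stub_ljSqTaylor : ∀ s₀ ε : ℝ, 0 < s₀ → |ε| ≤ s₀ / 5 →
    |(1 / 12 * ((s₀ + ε)⁻¹) ^ 6 - 1 / 6 * ((s₀ + ε)⁻¹) ^ 3) - (1 / 12 * (s₀⁻¹) ^ 6 - 1 / 6 * (s₀⁻¹) ^ 3)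
      - ljSqDeriv s₀ * ε - 1 / 2 * (1 / 2 * (7 * (s₀⁻¹) ^ 8 - 4 * (s₀⁻¹) ^ 5)) * ε ^ 2|
      ≤ (35 * (s₀⁻¹) ^ 9 + 7 * (s₀⁻¹) ^ 6) * |ε| ^ 3 := by
  intro s₀ ε hs hε
  have hε' := abs_le.1 hε
  have ht : 0 < s₀ + ε := by linarith [hε'.1]
  simp only [ljSqDeriv]
  rw [ljSqTaylor_identity s₀ ε hs.ne' ht.ne']
  set x : ℝ := s₀⁻¹ with hxdef
  set y : ℝ := (s₀ + ε)⁻¹ with hydef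
  have hx : 0 < x := inv_pos.2 hs
  have hy : 0 < y := inv_pos.2 ht
  have hrel : y * (1 + ε * x) = x := by
    rw [hxdef, hydef]; field_simp
  have hu : |ε * x| ≤ 1 / 5 := by
    rw [abs_mul, abs_of_pos hx]
    calc |ε| * x ≤ s₀ / 5 * x := mul_le_mul_of_nonneg_right hε hx.le
      _ = 1 / 5 := by rw [hxdef]; field_simp
  have h6 := ljSqTaylor_bound6 (ε * x) x y hu hy hrel
  have h3 := ljSqTaylor_bound3 (ε * x) x y hu hy hrel
  have hux : |ε * x| ^ 3 = |ε| ^ 3 * x ^ 3 := by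
    rw [abs_mul, abs_of_pos hx, mul_pow]
  rw [abs_mul, abs_neg, abs_pow, hux]
  have hA : |y ^ 6 * (56 + 210 * (ε * x) + 336 * (ε * x) ^ 2 + 280 * (ε * x) ^ 3 + 120 * (ε * x) ^ 4
        + 21 * (ε * x) ^ 5) / 12 - y ^ 3 * (10 + 15 * (ε * x) + 6 * (ε * x) ^ 2) / 6|
      ≤ 35 * x ^ 6 + 7 * x ^ 3 := by
    refine (abs_sub _ _).trans ?_
    rw [abs_div, abs_div, abs_of_pos (by norm_num : (0:ℝ) < 12), abs_of_pos (by norm_num : (0:ℝ) < 6)]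
    linarith
  have hε3 : 0 ≤ |ε| ^ 3 * x ^ 3 := by positivity
  calc |ε| ^ 3 * x ^ 3 * |y ^ 6 * (56 + 210 * (ε * x) + 336 * (ε * x) ^ 2 + 280 * (ε * x) ^ 3
          + 120 * (ε * x) ^ 4 + 21 * (ε * x) ^ 5) / 12 - y ^ 3 * (10 + 15 * (ε * x) + 6 * (ε * x) ^ 2) / 6|
      ≤ |ε| ^ 3 * x ^ 3 * (35 * x ^ 6 + 7 * x ^ 3) := mul_le_mul_of_nonneg_left hA hε3
    _ = (35 * x ^ 9 + 7 * x ^ 6) * |ε| ^ 3 := by ring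

end Summit.AtomisticToContinuum.Crystallization.Theorems.StrictSplittingRuleBirth

end
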